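import Literature.NumberTheory.Automorphic.RankinSelbergIntegralResidue
import Literature.NumberTheory.Automorphic.SmoothedCuspForms
import Literature.NumberTheory.Automorphic.GLnCuspidalSiegelDecay
import Literature.NumberTheory.Automorphic.CuspidalTestVector
import Literature.NumberTheory.Automorphic.StandardTestFunGaussian
import HarnessLib

/-!
# The residue datum of the Rankin–Selberg method: `Res_{s=1} I(s; φ̄, φ, Φ) = c Φ̂(0) ‖φ‖² ≠ 0`

Topic `NumberTheory/Automorphic`; namespace `Literature.NumberTheory.Automorphic`. Proof file (theorems
only). The residue of the global Rankin–Selberg integral at `s = 1`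
(`tendsto_sub_one_mul_rankinSelbergIntegral`, `RankinSelbergIntegralResidue`; Cogdell (2004), §2.3,
p. 211; Jacquet–Shalika (1981), §4) is specialised to the data of the proof of Jacquet–Shalika's
Prop. 3.6 / Arthur–Clozel's (2.3) (hypothesis (ii) of
`JacquetShalika1981_partialPairL_pole_of_eq_conj_of_rankinSelberg`, `PairLFunctionPolesRankinSelberg`):
`φ' = φ` a smoothed vector `S_η f` of a cuspidal automorphic representation `Π` (`smoothedForm`,
`SmoothedAutomorphicForms`; `η` a test function, `IsTestFunctionGL`) and `φ̄` its conjugate, so that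

  `(s - 1) I(s; φ̄, φ, Φ) ⟶ R · ‖φ‖²_{L²(μ')}`, `R = c_D V Φ̂(0) / n`, and `R ‖φ‖² ≠ 0`

as soon as `Φ̂(0) = ∫ Φ ≠ 0` and `S_η f ≠ 0` (such `f`, `η` exist in every cuspidal `Π`,
`CuspidalAutomorphicRepGL.exists_isTestFunctionGL_smoothedForm_ne_zero` of `CuspidalTestVector`):

* `isRapidlyDecreasingGL_invQuot_star` — rapid decay is insensitive to complex conjugation;
* `smoothedForm_mem_cuspForms`, `cuspFormsToLp_smoothedForm_eq`, `cuspFormsToLp_smoothedForm_mem` — the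
  smoothed form `S_η f` (`f ∈ Π`) is a continuous square-integrable cusp form whose `L²`-class is the
  smoothed vector `∫ η(g) g·f dg ∈ Π` (`isContinuousCuspForm_smoothedForm`, `smoothedVector_ae_eq`);
* `integral_star_mul_self_eq`, `integral_norm_sq_pos_of_ne_zero` — `∫ φ̄ φ dμ' = ‖φ‖²₂ > 0` for a
  continuous `φ ∈ ℒ²`, `φ ≠ 0`, and an automorphic (open-positive) measure;
* `residueConstant_ne_zero` — `c_D V Φ̂(0) / n ≠ 0` when `∫ Φ ≠ 0` (`0 < μ(Dⁿ) < ∞`,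
  `0 < idelicCovolume < ∞`);
* `CuspidalAutomorphicRepGL.tendsto_sub_one_mul_rankinSelbergIntegral_smoothedForm` (**main**) and
  `CuspidalAutomorphicRepGL.exists_residue_datum` — for `f ∈ Π`, a test function `η` with `S_η f ≠ 0`
  and `Φ ∈ piSchwartzBruhat K (Fin n)` with `∫ Φ dμ ≠ 0`: `φ = S_η f ∈ cuspForms`, `[φ] ∈ Π`, and
  `(s - 1) I(s; φ̄, φ, Φ) → r ≠ 0` (`s → 1`, `re s > 1`); `CuspidalAutomorphicRepGL.exists_cuspForm_residue_ne_zero`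
  — hence such a `φ` exists in every cuspidal `Π` (hypothesis (ii) of the reduction, unconditionally);
  `…_gauss` — the same with the Gaussian standard test function of `StandardTestFunGaussian`;
* `JacquetShalika1981_partialPairL_pole_of_eq_conj_of_unfolding` — consequently Arthur–Clozel's (2.3)
  (`JacquetShalika1981_partialPairL_pole_of_eq_conj`, `PairLFunctionPoles`) follows from the two
  remaining inputs of the method for such a datum: the unfolding / Euler factorisation
  `I(s; φ̄, φ, Φ) = A(s) L^S(s, α ⊗ β)` on `re s > 1` and the local limit `A(s) → a ≠ 0` at `s = 1`
  (not proved here); `…_of_unfolding_gauss` — the same with `Φ` the Gaussian standard test function.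

## References

* J. W. Cogdell, *Analytic theory of L-functions for GL_n*, in *An Introduction to the Langlands
  Program* (2004), §2.3, p. 211 [CogdellAnalyticTheory2004].
* H. Jacquet, J. A. Shalika, Amer. J. Math. 103 (1981), §4; 103 (1981), 777–815, Prop. 3.6
  [JacquetShalikaAJM1981].
-/

noncomputable section

open scoped NNReal ENNReal Topology ComplexConjugate
open NumberField IsDedekindDomain MeasureTheory Measure Filter Set

namespace Literature.NumberTheory.Automorphic

variable {n : ℕ} {K : Type} [Field K] [NumberField K]

attribute [local instance] adelicBorel borelSpace_adelic locallyCompactSpace_adelic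
  secondCountableTopology_gl_adelic

/-! ### Conjugation and rapid decay -/

/-- Rapid decay of the classical function is insensitive to complex conjugation
(`‖conj z‖ = ‖z‖`). [folklore] -/
theorem isRapidlyDecreasingGL_invQuot_star {φ : (AdelicGroupData.gl n K).automorphicQuotient → ℂ}
    (h : IsRapidlyDecreasingGL n K (invQuot (AdelicGroupData.gl n K) φ)) :
    IsRapidlyDecreasingGL n K (invQuot (AdelicGroupData.gl n K) (star φ)) := by
  intro Ω hΩ t ht B hB
  obtain ⟨C, hC⟩ := h Ω hΩ t ht B hB
  refine ⟨C, fun a ha hr y hy i j hij => ?_⟩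
  have h1 := hC a ha hr y hy i j hij
  rw [invQuot_apply] at h1 ⊢
  rw [Pi.star_apply, norm_star]
  exact h1

/-! ### The smoothed form as a cusp form with class in `Π` -/

section Smoothed

variable {μ' : Measure (AdelicGroupData.gl n K).automorphicQuotient}
  [(AdelicGroupData.gl n K).IsAutomorphicMeasure μ']

/-- **The smoothed form of a vector of a cuspidal representation is a continuous square-integrable
cusp form** (`isContinuousCuspForm_smoothedForm`, `Π ≤ L²_cusp`). [folklore] -/
theorem smoothedForm_mem_cuspForms (P : CuspidalAutomorphicRepGL n K μ')
    {η : (AdelicGroupData.gl n K).Adelic → ℝ} (hη : Continuous η) (hηs : HasCompactSupport η)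
    (f : P.1.toSubmodule) :
    smoothedForm η (f : (AdelicGroupData.gl n K).L2 μ') ∈ cuspForms n K μ' :=
  mem_cuspForms_iff.2 (isContinuousCuspForm_smoothedForm hη hηs (P.le_cuspidalSubspace f.2))

/-- **The `L²`-class of the smoothed form is the smoothed vector** `∫ η(g) g·f dg ∈ Π`
(`smoothedVector_ae_eq`). [folklore] -/
theorem cuspFormsToLp_smoothedForm_eq (P : CuspidalAutomorphicRepGL n K μ')
    {η : (AdelicGroupData.gl n K).Adelic → ℝ} (hη : Continuous η) (hηs : HasCompactSupport η)
    (f : P.1.toSubmodule) :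
    cuspFormsToLp n K μ' ⟨smoothedForm η (f : (AdelicGroupData.gl n K).L2 μ'),
        smoothedForm_mem_cuspForms P hη hηs f⟩ =
      (smoothedVector P.1 η f : (AdelicGroupData.gl n K).L2 μ') := by
  apply Lp.ext
  have h1 : ((cuspFormsToLp n K μ' ⟨smoothedForm η (f : (AdelicGroupData.gl n K).L2 μ'),
      smoothedForm_mem_cuspForms P hη hηs f⟩ : (AdelicGroupData.gl n K).L2 μ') :
        (AdelicGroupData.gl n K).automorphicQuotient → ℂ) =ᵐ[μ']
      smoothedForm η (f : (AdelicGroupData.gl n K).L2 μ') :=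
    MemLp.coeFn_toLp (memLp_of_mem_cuspForms (smoothedForm_mem_cuspForms P hη hηs f))
  exact h1.trans (smoothedVector_ae_eq P.1 hη hηs f).symm

/-- **The `L²`-class of the smoothed form lies in `Π`.** [folklore] -/
theorem cuspFormsToLp_smoothedForm_mem (P : CuspidalAutomorphicRepGL n K μ')
    {η : (AdelicGroupData.gl n K).Adelic → ℝ} (hη : Continuous η) (hηs : HasCompactSupport η)
    (f : P.1.toSubmodule) :
    cuspFormsToLp n K μ' ⟨smoothedForm η (f : (AdelicGroupData.gl n K).L2 μ'),
        smoothedForm_mem_cuspForms P hη hηs f⟩ ∈ P.1 := by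
  rw [cuspFormsToLp_smoothedForm_eq P hη hηs f]
  exact (smoothedVector P.1 η f).2

/-! ### `∫ φ̄ φ = ‖φ‖²₂ > 0` -/

omit [(AdelicGroupData.gl n K).IsAutomorphicMeasure μ'] in
/-- `∫ φ̄ φ dμ' = ∫ ‖φ‖² dμ'` (as a complex number). [folklore] -/
theorem integral_star_mul_self_eq (φ : (AdelicGroupData.gl n K).automorphicQuotient → ℂ) :
    ∫ x, star φ x * φ x ∂μ' = ((∫ x, ‖φ x‖ ^ 2 ∂μ' : ℝ) : ℂ) := by
  rw [← integral_complex_ofReal]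
  refine integral_congr_ae (Eventually.of_forall fun x => ?_)
  show star (φ x) * φ x = (((‖φ x‖ ^ 2 : ℝ)) : ℂ)
  rw [Complex.star_def, Complex.conj_mul', Complex.ofReal_pow]

/-- **`‖φ‖²₂ > 0` for a non-zero continuous `φ ∈ ℒ²(μ')`** and an automorphic measure `μ'` (which charges
non-empty open sets). [folklore] -/
theorem integral_norm_sq_pos_of_ne_zero {φ : (AdelicGroupData.gl n K).automorphicQuotient → ℂ}
    (hφc : Continuous φ) (hφ2 : MemLp φ 2 μ') (hφ0 : φ ≠ 0) :
    0 < ∫ x, ‖φ x‖ ^ 2 ∂μ' := by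
  have hint : Integrable (fun x => ‖φ x‖ ^ 2) μ' :=
    (memLp_two_iff_integrable_sq_norm hφc.aestronglyMeasurable).1 hφ2
  rw [integral_pos_iff_support_of_nonneg (fun x => sq_nonneg _) hint]
  have hsupp : Function.support (fun x => ‖φ x‖ ^ 2) = Function.support φ := by
    ext x
    simp only [Function.mem_support, ne_eq, pow_eq_zero_iff two_ne_zero, norm_eq_zero]
  rw [hsupp]
  refine (hφc.isOpen_support).measure_pos μ' ?_
  rw [Function.support_nonempty_iff]
  exact hφ0

end Smoothed

/-! ### The residue constant -/

section Residue

variable [MeasurableSpace (AdeleRing (𝓞 K) K)] [BorelSpace (AdeleRing (𝓞 K) K)]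

attribute [local instance] borelSpace_ideleGroup

/-- **`R = c_D V Φ̂(0) / n ≠ 0`** when `Φ̂(0) = ∫ Φ ≠ 0` (`n ≥ 1`): the Tate domain `Dⁿ` has positive finite
measure (`isAddFundamentalDomain_op_piFundamentalDomain`, `isCompact_closure_piFundamentalDomain`) and the
idelic covolume is positive and finite (`idelicCovolume_pos`, `idelicCovolume_ne_top`). [folklore] -/
theorem residueConstant_ne_zero (hn : 0 < n) (ν : Measure (GaloisRepresentations.ideleGroup K))
    [ν.IsHaarMeasure] (μ : Measure (Fin n → AdeleRing (𝓞 K) K)) [μ.IsAddHaarMeasure]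
    {Φ : (Fin n → AdeleRing (𝓞 K) K) → ℂ} (hΦ0 : ∫ v, Φ v ∂μ ≠ 0) :
    (((μ (piFundamentalDomain K (Fin n))).toReal⁻¹ : ℝ) : ℂ) * ((idelicCovolume K ν).toReal : ℂ) *
        (∫ v, Φ v ∂μ) / n ≠ 0 := by
  haveI := locallyCompactSpace_adeleRing' K
  haveI := secondCountableTopology_adeleRing K
  haveI := t2Space_adeleRing K
  haveI : Countable K := NumberField.countable' (K := K)
  haveI : BorelSpace (Fin n → AdeleRing (𝓞 K) K) := Pi.borelSpace
  have hfin : μ (piFundamentalDomain K (Fin n)) ≠ ⊤ :=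
    ((measure_mono subset_closure).trans_lt
      (isCompact_closure_piFundamentalDomain K (Fin n)).measure_lt_top).ne
  have hpos : 0 < (μ (piFundamentalDomain K (Fin n))).toReal :=
    ENNReal.toReal_pos (Literature.Analysis.Fourier.measure_fundamentalDomain_ne_zero μ
      (isAddFundamentalDomain_op_piFundamentalDomain K (Fin n) μ)) hfin
  have hV : 0 < (idelicCovolume K ν).toReal :=
    ENNReal.toReal_pos (idelicCovolume_pos ν).ne' (idelicCovolume_ne_top ν)
  have hn0 : (n : ℂ) ≠ 0 := Nat.cast_ne_zero.2 hn.ne'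
  refine div_ne_zero (mul_ne_zero (mul_ne_zero ?_ ?_) hΦ0) hn0
  · exact Complex.ofReal_ne_zero.2 (inv_ne_zero hpos.ne')
  · exact Complex.ofReal_ne_zero.2 hV.ne'

/-! ### The residue of `I(s; φ̄, φ, Φ)` for a smoothed cuspidal vector -/

variable {μ' : Measure (AdelicGroupData.gl n K).automorphicQuotient}
  [(AdelicGroupData.gl n K).IsAutomorphicMeasure μ']

/-- **`(s - 1) I(s; φ̄, φ, Φ) → c_D V Φ̂(0) / n · ‖φ‖²₂` for `φ = S_η f`, `f ∈ Π` cuspidal, `η` a test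
function, `Φ ∈ piSchwartzBruhat K (Fin n)`** (`tendsto_sub_one_mul_rankinSelbergIntegral` with
`φ̄ = star φ`, both continuous with rapidly decreasing classical functions:
`isRapidlyDecreasingGL_invQuot_smoothedForm`, `isRapidlyDecreasingGL_invQuot_star`; and
`∫ φ̄ φ = ‖φ‖²₂`). Cogdell (2004), §2.3, p. 211: `Res_{s=1} I(s; φ, φ', Φ) = c Φ̂(0) ∫ φ̃ φ̃'`.
[cite: CogdellAnalyticTheory2004, §2.3, p. 211] -/
theorem CuspidalAutomorphicRepGL.tendsto_sub_one_mul_rankinSelbergIntegral_smoothedForm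
    (P : CuspidalAutomorphicRepGL n K μ') (hn : 0 < n)
    (ν : Measure (GaloisRepresentations.ideleGroup K)) [ν.IsHaarMeasure] [ν.IsMulRightInvariant]
    (μ : Measure (Fin n → AdeleRing (𝓞 K) K)) [μ.IsAddHaarMeasure]
    {Φ : (Fin n → AdeleRing (𝓞 K) K) → ℂ} (hΦ : Φ ∈ piSchwartzBruhat K (Fin n))
    {η : (AdelicGroupData.gl n K).Adelic → ℝ} (hη : IsTestFunctionGL n K η) (f : P.1.toSubmodule) :
    Tendsto (fun s => (s - 1) * rankinSelbergIntegral μ' ν Φ s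
        (star (smoothedForm η (f : (AdelicGroupData.gl n K).L2 μ')))
        (smoothedForm η (f : (AdelicGroupData.gl n K).L2 μ')))
      (𝓝[{s : ℂ | 1 < s.re}] 1)
      (𝓝 ((((μ (piFundamentalDomain K (Fin n))).toReal⁻¹ : ℝ) : ℂ) * ((idelicCovolume K ν).toReal : ℂ) *
          (∫ v, Φ v ∂μ) / n *
          ((∫ x, ‖smoothedForm η (f : (AdelicGroupData.gl n K).L2 μ') x‖ ^ 2 ∂μ' : ℝ) : ℂ))) := by
  set φ : (AdelicGroupData.gl n K).automorphicQuotient → ℂ :=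
    smoothedForm η (f : (AdelicGroupData.gl n K).L2 μ') with hφ
  have hφc : Continuous φ := continuous_smoothedForm hη.continuous hη.hasCompactSupport _
  have hφd : IsRapidlyDecreasingGL n K (invQuot (AdelicGroupData.gl n K) φ) :=
    isRapidlyDecreasingGL_invQuot_smoothedForm hη (P.le_cuspidalSubspace f.2)
  have h := tendsto_sub_one_mul_rankinSelbergIntegral (K := K) ν hn μ' μ hΦ (φ := star φ) (φ' := φ)
    hφc.star hφc (isRapidlyDecreasingGL_invQuot_star hφd) hφd
  rw [integral_star_mul_self_eq] at h
  exact h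

/-- **The residue datum of the Rankin–Selberg method** (hypothesis (ii), with its side conditions, of
`JacquetShalika1981_partialPairL_pole_of_eq_conj_of_rankinSelberg`): for a cuspidal automorphic
representation `Π` of `GL_n(𝔸_K)` (`n ≥ 1`), `f ∈ Π`, a test function `η` with `S_η f ≠ 0`, Haar
measures `ν` on `𝔸_Kˣ` and `μ` on `𝔸_Kⁿ`, and `Φ ∈ piSchwartzBruhat K (Fin n)` with `∫ Φ dμ ≠ 0`: the
smoothed form `φ = S_η f` is a continuous square-integrable cusp form with `[φ] ∈ Π`, and
`(s - 1) I(s; φ̄, φ, Φ) → r` with `r = c_D V Φ̂(0) ‖φ‖²₂ / n ≠ 0` as `s → 1`, `re s > 1`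
(Cogdell (2004), §2.3, p. 211; Jacquet–Shalika II, Prop. 3.6: the pole of `L^S(s, π × π̃)` at `s = 1`
comes from this residue). Such `(f, η)` exist in every `Π`
(`CuspidalAutomorphicRepGL.exists_isTestFunctionGL_smoothedForm_ne_zero`).
[cite: CogdellAnalyticTheory2004, §2.3, p. 211] -/
theorem CuspidalAutomorphicRepGL.exists_residue_datum (P : CuspidalAutomorphicRepGL n K μ') (hn : 0 < n)
    (ν : Measure (GaloisRepresentations.ideleGroup K)) [ν.IsHaarMeasure] [ν.IsMulRightInvariant]
    (μ : Measure (Fin n → AdeleRing (𝓞 K) K)) [μ.IsAddHaarMeasure]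
    {Φ : (Fin n → AdeleRing (𝓞 K) K) → ℂ} (hΦ : Φ ∈ piSchwartzBruhat K (Fin n)) (hΦ0 : ∫ v, Φ v ∂μ ≠ 0)
    {η : (AdelicGroupData.gl n K).Adelic → ℝ} (hη : IsTestFunctionGL n K η) (f : P.1.toSubmodule)
    (hne : smoothedForm η (f : (AdelicGroupData.gl n K).L2 μ') ≠ 0) :
    ∃ (hφ : smoothedForm η (f : (AdelicGroupData.gl n K).L2 μ') ∈ cuspForms n K μ') (r : ℂ),
      cuspFormsToLp n K μ' ⟨smoothedForm η (f : (AdelicGroupData.gl n K).L2 μ'), hφ⟩ ∈ P.1 ∧ r ≠ 0 ∧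
      Tendsto (fun s => (s - 1) * rankinSelbergIntegral μ' ν Φ s
          (star (smoothedForm η (f : (AdelicGroupData.gl n K).L2 μ')))
          (smoothedForm η (f : (AdelicGroupData.gl n K).L2 μ')))
        (𝓝[{s : ℂ | 1 < s.re}] 1) (𝓝 r) := by
  have hφ := smoothedForm_mem_cuspForms P hη.continuous hη.hasCompactSupport f
  refine ⟨hφ, _, cuspFormsToLp_smoothedForm_mem P hη.continuous hη.hasCompactSupport f, ?_,
    P.tendsto_sub_one_mul_rankinSelbergIntegral_smoothedForm hn ν μ hΦ hη f⟩
  refine mul_ne_zero (residueConstant_ne_zero hn ν μ hΦ0) (Complex.ofReal_ne_zero.2 ?_)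
  exact (integral_norm_sq_pos_of_ne_zero hφ.1 hφ.2.1 hne).ne'

/-- **Hypothesis (ii) of the Rankin–Selberg method holds in every cuspidal representation**: for `Π`
cuspidal on `GL_n(𝔸_K)` (`n ≥ 1`), Haar measures `ν`, `μ` and `Φ ∈ piSchwartzBruhat K (Fin n)` with
`∫ Φ dμ ≠ 0` there is a continuous square-integrable cusp form `φ` with `[φ] ∈ Π` and
`(s - 1) I(s; φ̄, φ, Φ) → r ≠ 0` (`s → 1`, `re s > 1`) — `φ = S_η f` for the non-zero test-function
smoothing of `CuspidalAutomorphicRepGL.exists_isTestFunctionGL_smoothedForm_ne_zero`.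
[cite: CogdellAnalyticTheory2004, §2.3, p. 211] -/
theorem CuspidalAutomorphicRepGL.exists_cuspForm_residue_ne_zero (P : CuspidalAutomorphicRepGL n K μ')
    (hn : 0 < n) (ν : Measure (GaloisRepresentations.ideleGroup K)) [ν.IsHaarMeasure] [ν.IsMulRightInvariant]
    (μ : Measure (Fin n → AdeleRing (𝓞 K) K)) [μ.IsAddHaarMeasure]
    {Φ : (Fin n → AdeleRing (𝓞 K) K) → ℂ} (hΦ : Φ ∈ piSchwartzBruhat K (Fin n)) (hΦ0 : ∫ v, Φ v ∂μ ≠ 0) :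
    ∃ (φ : (AdelicGroupData.gl n K).automorphicQuotient → ℂ) (hφ : φ ∈ cuspForms n K μ') (r : ℂ),
      cuspFormsToLp n K μ' ⟨φ, hφ⟩ ∈ P.1 ∧ r ≠ 0 ∧
      Tendsto (fun s => (s - 1) * rankinSelbergIntegral μ' ν Φ s (star φ) φ)
        (𝓝[{s : ℂ | 1 < s.re}] 1) (𝓝 r) := by
  obtain ⟨f, η, hη, -, hne, -⟩ := P.exists_isTestFunctionGL_smoothedForm_ne_zero
  obtain ⟨hφ, r, hmem, hr, hT⟩ := P.exists_residue_datum hn ν μ hΦ hΦ0 hη f hne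
  exact ⟨_, hφ, r, hmem, hr, hT⟩

/-! ### The Gaussian datum -/

/-- **Hypothesis (ii) with the Gaussian standard test function** `Φ = e^{-‖T z_∞‖²} ⊗ 𝟙_{𝒪̂ⁿ}`
(`standardTestFun n K (gaussArchTestFun n K)`, `StandardTestFunGaussian`: in `piSchwartzBruhat`, with
`∫ Φ ≠ 0`): in every cuspidal `Π` there is a continuous square-integrable cusp form `φ` with `[φ] ∈ Π` and
`(s - 1) I(s; φ̄, φ, Φ) → r ≠ 0`. [cite: CogdellAnalyticTheory2004, §2.3, p. 211] -/
theorem CuspidalAutomorphicRepGL.exists_cuspForm_residue_ne_zero_gauss (P : CuspidalAutomorphicRepGL n K μ')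
    (hn : 0 < n) (ν : Measure (GaloisRepresentations.ideleGroup K)) [ν.IsHaarMeasure] [ν.IsMulRightInvariant]
    (μ : Measure (Fin n → AdeleRing (𝓞 K) K)) [μ.IsAddHaarMeasure] :
    ∃ (φ : (AdelicGroupData.gl n K).automorphicQuotient → ℂ) (hφ : φ ∈ cuspForms n K μ') (r : ℂ),
      cuspFormsToLp n K μ' ⟨φ, hφ⟩ ∈ P.1 ∧ r ≠ 0 ∧
      Tendsto (fun s => (s - 1) * rankinSelbergIntegral μ' ν
          (fun y => ((standardTestFun n K (gaussArchTestFun n K) y : ℝ) : ℂ)) s (star φ) φ)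
        (𝓝[{s : ℂ | 1 < s.re}] 1) (𝓝 r) :=
  P.exists_cuspForm_residue_ne_zero hn ν μ (standardTestFun_gauss_mem_piSchwartzBruhat n K)
    (integral_ofReal_standardTestFun_gauss_ne_zero n K μ)

/-! ### Arthur–Clozel (2.3) from the unfolding identity for the smoothed datum -/

/-- **Arthur–Clozel's (2.3) reduced to the unfolding identity and the local limit for the smoothed
datum.** With the residue datum supplied by this file (hypothesis (ii) of
`JacquetShalika1981_partialPairL_pole_of_eq_conj_of_rankinSelberg`: `(s - 1) I(s; φ̄, φ, Φ) → r ≠ 0`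
for `φ = S_η f`, `f ∈ σ`, `S_η f ≠ 0`, `∫ Φ ≠ 0`), the statement
`JacquetShalika1981_partialPairL_pole_of_eq_conj` follows from the remaining two inputs of the
Rankin–Selberg method, to be supplied for SOME such datum in every instance: (iii) the unfolding /
Euler factorisation `I(s; φ̄, φ, Φ) = A(s) L^S(s, α ⊗ β)` on `re s > 1` (Jacquet–Shalika I, §4 and II, §3;
Cogdell (2004), Thm. 2.2 with §4.2) and (i) `A(s) → a ≠ 0` as `s → 1`, `re s > 1` (the local integrals at
the places of `S ∪ S_∞`, absolutely convergent up to `re s = 1` and non-zero at `s = 1` for suitable data: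
Jacquet–Shalika I, §§1–3). [cite: ArthurClozelAMS120, Ch. 3 §2 (2.3)] -/
theorem JacquetShalika1981_partialPairL_pole_of_eq_conj_of_unfolding
    (h : ∀ (_hn : 0 < n) (P P' : CuspidalAutomorphicRepGL n K μ') (_he : P = P'.conj)
      {S : Set (HeightOneSpectrum (𝓞 K))} (_hS : S.Finite)
      {α β : SatakeFamily K} (_hα : IsSatakeFamilyOf P S α) (_hβ : IsSatakeFamilyOf P' S β),
      ∃ (ν : Measure (GaloisRepresentations.ideleGroup K)) (_ : ν.IsHaarMeasure) (_ : ν.IsMulRightInvariant)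
        (μ : Measure (Fin n → AdeleRing (𝓞 K) K)) (_ : μ.IsAddHaarMeasure)
        (Φ : (Fin n → AdeleRing (𝓞 K) K) → ℂ) (η : (AdelicGroupData.gl n K).Adelic → ℝ)
        (f : P'.1.toSubmodule) (A : ℂ → ℂ) (a : ℂ),
        Φ ∈ piSchwartzBruhat K (Fin n) ∧ ∫ v, Φ v ∂μ ≠ 0 ∧ IsTestFunctionGL n K η ∧
        smoothedForm η (f : (AdelicGroupData.gl n K).L2 μ') ≠ 0 ∧ a ≠ 0 ∧
        Tendsto A (𝓝[{s : ℂ | 1 < s.re}] 1) (𝓝 a) ∧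
        ∀ s : ℂ, 1 < s.re →
          rankinSelbergIntegral μ' ν Φ s (star (smoothedForm η (f : (AdelicGroupData.gl n K).L2 μ')))
            (smoothedForm η (f : (AdelicGroupData.gl n K).L2 μ')) = A s * partialPairL S α β s) :
    JacquetShalika1981_partialPairL_pole_of_eq_conj (n := n) (K := K) (μ := μ') := by
  intro hn P P' he S hS α β hα hβ
  obtain ⟨ν, _hν, _hν', μ, _hμ, Φ, η, f, A, a, hΦ, hΦ0, hη, hne, ha, hA, hIAL⟩ := h hn P P' he hS hα hβ
  obtain ⟨_hφ, r, -, hr, hI⟩ := P'.exists_residue_datum hn ν μ hΦ hΦ0 hη f hne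
  exact exists_ne_zero_tendsto_mul_of_eventuallyEq hI hA ha hr
    (eventually_nhdsWithin_of_forall fun s hs => hIAL s hs)

/-- **Arthur–Clozel's (2.3) from the unfolding identity and the local limit for the Gaussian smoothed
datum** (`JacquetShalika1981_partialPairL_pole_of_eq_conj_of_unfolding` with
`Φ = standardTestFun n K (gaussArchTestFun n K)`, whose Schwartz–Bruhat membership and `∫ Φ ≠ 0` are
theorems of `StandardTestFunGaussian`): it remains to produce, for every instance, a test function `η`,
a vector `f ∈ σ` with `S_η f ≠ 0`, and `A`, `a ≠ 0` with `A(s) → a` and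
`I(s; φ̄, φ, Φ) = A(s) L^S(s, α ⊗ β)` on `re s > 1` (`φ = S_η f`).
[cite: ArthurClozelAMS120, Ch. 3 §2 (2.3)] -/
theorem JacquetShalika1981_partialPairL_pole_of_eq_conj_of_unfolding_gauss
    (h : ∀ (_hn : 0 < n) (P P' : CuspidalAutomorphicRepGL n K μ') (_he : P = P'.conj)
      {S : Set (HeightOneSpectrum (𝓞 K))} (_hS : S.Finite)
      {α β : SatakeFamily K} (_hα : IsSatakeFamilyOf P S α) (_hβ : IsSatakeFamilyOf P' S β),
      ∃ (ν : Measure (GaloisRepresentations.ideleGroup K)) (_ : ν.IsHaarMeasure) (_ : ν.IsMulRightInvariant)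
        (μ : Measure (Fin n → AdeleRing (𝓞 K) K)) (_ : μ.IsAddHaarMeasure)
        (η : (AdelicGroupData.gl n K).Adelic → ℝ) (f : P'.1.toSubmodule) (A : ℂ → ℂ) (a : ℂ),
        IsTestFunctionGL n K η ∧ smoothedForm η (f : (AdelicGroupData.gl n K).L2 μ') ≠ 0 ∧ a ≠ 0 ∧
        Tendsto A (𝓝[{s : ℂ | 1 < s.re}] 1) (𝓝 a) ∧
        ∀ s : ℂ, 1 < s.re →
          rankinSelbergIntegral μ' ν (fun y => ((standardTestFun n K (gaussArchTestFun n K) y : ℝ) : ℂ)) s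
            (star (smoothedForm η (f : (AdelicGroupData.gl n K).L2 μ')))
            (smoothedForm η (f : (AdelicGroupData.gl n K).L2 μ')) = A s * partialPairL S α β s) :
    JacquetShalika1981_partialPairL_pole_of_eq_conj (n := n) (K := K) (μ := μ') := by
  refine JacquetShalika1981_partialPairL_pole_of_eq_conj_of_unfolding fun hn P P' he S hS α β hα hβ => ?_
  obtain ⟨ν, hν, hν', μ, hμ, η, f, A, a, hη, hne, ha, hA, hIAL⟩ := h hn P P' he hS hα hβ
  exact ⟨ν, hν, hν', μ, hμ, _, η, f, A, a, standardTestFun_gauss_mem_piSchwartzBruhat n K,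
    integral_ofReal_standardTestFun_gauss_ne_zero n K μ, hη, hne, ha, hA, hIAL⟩

end Residue

end Literature.NumberTheory.Automorphic
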